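import Summits.Parity.GeneralizedHardyLittlewood.Theorems.FordMaynardSieveConst01651SieveConst01651KernelForm
import HarnessLib

/-!
# Route `FordMaynardSieveConst01651`, target `SieveConst01651` (stmt-Parity-19185), line `sieve_decomposition`,
# stub `stub_coneCertClosed`: the kernel normal form for CONE DATA `g₀`

Helper file (def-free), continuation of `…KernelForm` (K. Ford, J. Maynard, *On the theory of prime producing
sieves*, arXiv:2407.14368, Theorem 7.3 (a)).  The registered stub `stub_coneCertClosed` asks for cone data `g₀`
(values on ORDERED vectors only) with `0 < sieveBoundG1 ν₀ g₀`.  Writing `g = (k, x) ↦ g₀ k (x ∘ sort x)` for the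
symmetric extension (the `symmExt` of the lines `cone_table` / `sieve_decomposition`, spelled out as a lambda so that
this file stays definition-free), we prove

* `sieveBoundG1_symmExt'` — `V(ν, g) = V(ν, g₀)` (the integrand of `sieveBoundG1` only reads ordered vectors);
* `isSymmetric_symmExt'`, `isPiecewiseConstOnCone_symmExt'`, `support_symmExt'` — the extension inherits the
  certificate's shape hypotheses;
* `sliceFn_symmExt_eq_ordered` — the slice functions of the extension are `r!` times the ORDERED slice functions of
  the data: `∫_{|v|=t} 𝟙[vᵢ>ν] g_r(v)/∏ vᵢ = r! · ∫_{|v|=t} 𝟙[vᵢ>ν, v monotone] g₀,ᵣ(v)/∏ vᵢ` (`chamber_symm'`);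
* `sieveBoundG1_coneData_eq_kernelForm` — **the kernel normal form of `V(ν, g₀)` for cone data**:
  `V(ν, g₀) = 1 + ∑_{k=2}^{⌊1/ν⌋} (1/k!)·( g₀(∅) F_k(1) + ∑_{r=1}^{k−1} C(k,r)·r!·∫_{(0,1]} S⁰_r(t) F_{k−r}(1−t) dt )`
  with `S⁰_r(t) = ∫_{|v|=t} 𝟙[vᵢ > ν, v₁ ≤ ⋯ ≤ v_r] g₀,ᵣ(v)/∏ vᵢ` read directly off the ordered cell table and the
  universal kernels `F_m` of `…SliceKernel` — the shape in which the last conjunct of `stub_coneCertClosed` is a sum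
  of ONE-dimensional integrals.

The `symmExt` lemmas are ADAPTED FROM the line-writer's non-importable `Lines/cone_table.lean` /
`Lines/sieve_decomposition.lean` (planner-linewriter-parity-smallroutes-1 g0).

References: [FordMaynard2024PrimeSieves] arXiv:2407.14368, Theorem 7.3 (a), Definitions 6.1/7.1/7.2, Lemma 8.4, §4.2.
-/

noncomputable section

open MeasureTheory Set Finset
open scoped Classical
open Literature.NumberTheory.Sieve Literature.NumberTheory.Sieve.FordMaynard

namespace Summit.Parity.GeneralizedHardyLittlewood.FordMaynardSieveConst01651SieveConst01651

/-! ### The symmetric extension `(k, x) ↦ g₀ k (x ∘ sort x)` (lambda form) -/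

/-- On ordered vectors the extension is the data. [cite: FordMaynard2024PrimeSieves, Definition 6.1] -/
theorem symmExt_apply_of_monotone (g₀ : VecFn) {k : ℕ} {x : Fin k → ℝ} (hx : Monotone x) :
    g₀ k (x ∘ ⇑(Tuple.sort x)) = g₀ k x := by
  -- adapted from Lines/sieve_decomposition.lean (`symmExt_of_monotone`)
  rw [Tuple.sort_eq_refl_iff_monotone.mpr hx]
  simp

/-- The extension is symmetric (`∈ 𝒮`, Definition 6.1). [cite: FordMaynard2024PrimeSieves, Definition 6.1] -/
theorem isSymmetric_symmExt' (g₀ : VecFn) :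
    VecFn.IsSymmetric (fun k x => g₀ k (x ∘ ⇑(Tuple.sort x))) := by
  -- adapted from Lines/sieve_decomposition.lean (`isSymmetric_symmExt`)
  intro k σ x
  show g₀ k ((x ∘ σ) ∘ ⇑(Tuple.sort (x ∘ σ))) = g₀ k (x ∘ ⇑(Tuple.sort x))
  rw [Tuple.comp_perm_comp_sort_eq_comp_sort]

/-- The extension is piecewise constant on the cone if the data is. [cite: FordMaynard2024PrimeSieves, Definition 7.2 (sub-class)] -/
theorem isPiecewiseConstOnCone_symmExt' {g₀ : VecFn} (h : IsPiecewiseConstOnCone g₀) :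
    IsPiecewiseConstOnCone (fun k x => g₀ k (x ∘ ⇑(Tuple.sort x))) := by
  -- adapted from Lines/sieve_decomposition.lean (`isPiecewiseConstOnCone_symmExt`)
  intro k
  obtain ⟨m, P, c, hP, hg⟩ := h k
  refine ⟨m, P, c, hP, fun x hx => ?_⟩
  show g₀ k (x ∘ ⇑(Tuple.sort x)) = _
  rw [symmExt_apply_of_monotone g₀ hx]
  exact hg x hx

/-- The closed support clause transfers from ordered vectors to the extension.
[cite: FordMaynard2024PrimeSieves, (7.1) (the set 𝒢₁)] -/
theorem support_symmExt' {ν : ℝ} {g₀ : VecFn}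
    (h : ∀ (k : ℕ) (x : Fin k → ℝ), Monotone x → g₀ k x ≠ 0 →
      k = 0 ∨ ((∀ i, ν < x i) ∧ ∑ i, x i ≤ 1 / 2)) :
    ∀ (k : ℕ) (x : Fin k → ℝ), (fun k x => g₀ k (x ∘ ⇑(Tuple.sort x))) k x ≠ 0 →
      k = 0 ∨ ((∀ i, ν < x i) ∧ ∑ i, x i ≤ 1 / 2) := by
  -- adapted from Lines/sieve_decomposition.lean (`supportClosed_symmExt`)
  intro k x hne
  have hmono : Monotone (x ∘ ⇑(Tuple.sort x)) := Tuple.monotone_sort x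
  rcases h k _ hmono hne with h0 | ⟨hall, hsum⟩
  · exact Or.inl h0
  · refine Or.inr ⟨fun i => ?_, ?_⟩
    · simpa using hall ((Tuple.sort x).symm i)
    · have : (∑ i, (x ∘ ⇑(Tuple.sort x)) i) = ∑ i, x i := by
        simp only [Function.comp_apply]
        exact Equiv.sum_comp (Tuple.sort x) x
      rwa [this] at hsum

/-- On ordered vectors `starSum` of the extension is `starSum` of the data (ordered subvectors of an ordered vector
are ordered). [cite: FordMaynard2024PrimeSieves, Definition 7.1] -/
theorem starSum_symmExt_of_monotone' (g₀ : VecFn) {k : ℕ} {x : Fin k → ℝ} (hx : Monotone x) :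
    starSum (fun k x => g₀ k (x ∘ ⇑(Tuple.sort x))) k x = starSum g₀ k x := by
  -- adapted from Lines/sieve_decomposition.lean (`starSum_symmExt_of_monotone`)
  unfold starSum
  refine Finset.sum_congr rfl fun A _ => ?_
  exact symmExt_apply_of_monotone g₀ (hx.comp (A.orderEmbOfFin rfl).monotone)

/-- **`V(ν, ·)` only reads ordered vectors**: the extension and the data have the same `sieveBoundG1`.
[cite: FordMaynard2024PrimeSieves, Theorem 7.3 (a) (integration over x₁ ≤ ⋯ ≤ x_k)] -/
theorem sieveBoundG1_symmExt' (ν : ℝ) (g₀ : VecFn) :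
    sieveBoundG1 ν (fun k x => g₀ k (x ∘ ⇑(Tuple.sort x))) = sieveBoundG1 ν g₀ := by
  -- adapted from Lines/sieve_decomposition.lean (`sieveBoundG1_symmExt`)
  unfold sieveBoundG1
  congr 1
  refine Finset.sum_congr rfl fun k _ => ?_
  congr 1
  funext x
  split_ifs with h
  · rw [starSum_symmExt_of_monotone' g₀ h.2]
  · rfl

/-! ### Slice functions of the extension = `r!` × ordered slice functions of the data -/

/-- **`S_r(t) = r! · S⁰_r(t)`**: for cone data `g₀` piecewise constant on the cone and `ν > 0`,
`∫_{|v|=t} 𝟙[vᵢ>ν] g₀,ᵣ(v ∘ sort v)/∏ vᵢ = r! · ∫_{|v|=t} 𝟙[vᵢ>ν, v monotone] g₀,ᵣ(v)/∏ vᵢ`.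
[cite: FordMaynard2024PrimeSieves, Theorem 7.3 (a) with §4.2] -/
theorem sliceFn_symmExt_eq_ordered {g₀ : VecFn} (hpc : IsPiecewiseConstOnCone g₀) {ν : ℝ} (hν : 0 < ν)
    (r : ℕ) (t : ℝ) :
    sliceIntegral r t (fun v => if ∀ i, ν < v i then g₀ r (v ∘ ⇑(Tuple.sort v)) / ∏ i, v i else 0) =
      (r.factorial : ℝ) *
        sliceIntegral r t (fun v => if (∀ i, ν < v i) ∧ Monotone v then g₀ r v / ∏ i, v i else 0) := by
  have hs := isSymmetric_symmExt' g₀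
  have hpc' := isPiecewiseConstOnCone_symmExt' hpc
  obtain ⟨C, hC0, hC⟩ := exists_abs_apply_le_of_cone hs hpc' r
  have hsymm := chamber_symm' r t (C / ν ^ r)
    (fun v => if ∀ i, ν < v i then g₀ r (v ∘ ⇑(Tuple.sort v)) / ∏ i, v i else 0)
    (measurable_boxIntegrand ν (measurable_apply_of_cone hs hpc' r))
    (fun v => abs_boxIntegrand_le hν hC0 hC v) (fun σ u => ?_)
  · rw [hsymm]
    congr 1
    refine sliceIntegral_congr fun v _ _ => ?_
    by_cases hm : Monotone v
    · by_cases hb : ∀ i, ν < v i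
      · rw [if_pos hm, if_pos hb, if_pos ⟨hb, hm⟩, symmExt_apply_of_monotone g₀ hm]
      · rw [if_pos hm, if_neg hb, if_neg (fun h => hb h.1)]
    · rw [if_neg hm, if_neg (fun h => hm h.2)]
  · have hiff : (∀ i, ν < (u ∘ σ) i) ↔ ∀ i, ν < u i :=
      ⟨fun h i => by simpa using h (σ.symm i), fun h i => h _⟩
    have hprod : ∏ i, (u ∘ σ) i = ∏ i, u i := Equiv.prod_comp σ u
    have happ : g₀ r ((u ∘ σ) ∘ ⇑(Tuple.sort (u ∘ σ))) = g₀ r (u ∘ ⇑(Tuple.sort u)) := hs r σ u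
    simp only [hiff, hprod, happ]

/-! ### The kernel normal form for cone data -/

/-- **Kernel normal form of `V(ν, g₀)` for cone data.** For `ν > 0` and cone data `g₀` piecewise constant on the
ordered cone with the closed support clause on ordered vectors (`g₀,ₖ(x) ≠ 0, x monotone ⇒ k = 0 ∨ (xᵢ > ν ∀ i ∧ |x| ≤ 1/2)`,
as in `stub_coneCertClosed`):

`V(ν, g₀) = 1 + ∑_{k=2}^{⌊1/ν⌋} (1/k!)·( g₀(∅)·F_k(1) + ∑_{r=1}^{k−1} C(k,r)·( r!·∫_{t∈(0,1]} S⁰_r(t) F_{k−r}(1−t) dt ) )`,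

`S⁰_r(t) = ∫_{|v|=t} 𝟙[vᵢ > ν, v₁ ≤ ⋯ ≤ v_r] g₀,ᵣ(v)/∏ vᵢ` (ordered cell data only), `F_m(s) = ∫_{|u|=s} 𝟙[uⱼ>ν]/∏ uⱼ`
(`kernel_one`, `kernelTwo_eq_log`, `kernel_succ`).  At `ν = 0.1651` the support clause leaves `r ≤ 3` and `k ≤ 6`.
[cite: FordMaynard2024PrimeSieves, Theorem 7.3 (a) with Definition 7.1, (7.1), Lemma 8.4, §4.2] -/
theorem sieveBoundG1_coneData_eq_kernelForm {ν : ℝ} (hν : 0 < ν) {g₀ : VecFn} (hpc : IsPiecewiseConstOnCone g₀)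
    (hsupp : ∀ (k : ℕ) (x : Fin k → ℝ), Monotone x → g₀ k x ≠ 0 → k = 0 ∨ ((∀ i, ν < x i) ∧ ∑ i, x i ≤ 1 / 2)) :
    sieveBoundG1 ν g₀ = 1 + ∑ k ∈ Icc 2 ⌊1 / ν⌋₊, (1 / (k.factorial : ℝ)) *
      (g₀ 0 Fin.elim0 * sliceIntegral k 1 (fun u => if ∀ i, ν < u i then 1 / ∏ i, u i else 0) +
        ∑ r ∈ Ico 1 k, (k.choose r : ℝ) * ∫ t in Set.Ioc 0 1,
          ((r.factorial : ℝ) *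
            sliceIntegral r t (fun v => if (∀ i, ν < v i) ∧ Monotone v then g₀ r v / ∏ i, v i else 0)) *
            sliceIntegral (k - r) (1 - t) (fun u => if ∀ i, ν < u i then 1 / ∏ i, u i else 0)) := by
  have hs := isSymmetric_symmExt' g₀
  have hpc' := isPiecewiseConstOnCone_symmExt' hpc
  have hsupp' := support_symmExt' (ν := ν) hsupp
  rw [← sieveBoundG1_symmExt' ν g₀, sieveBoundG1_eq_kernelForm hν hs hpc' hsupp']
  -- the empty vector: `x ∘ sort x = x` on `Fin 0`; the slice functions: `S_r = r! · S⁰_r`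
  have h0 : g₀ 0 (Fin.elim0 ∘ ⇑(Tuple.sort (Fin.elim0 : Fin 0 → ℝ))) = g₀ 0 Fin.elim0 :=
    congrArg (g₀ 0) (Subsingleton.elim _ _)
  simp only [h0, sliceFn_symmExt_eq_ordered hpc hν]

end Summit.Parity.GeneralizedHardyLittlewood.FordMaynardSieveConst01651SieveConst01651

end
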